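import Summits.AtomisticToContinuum.BoseEinsteinCondensation.Theorems.BECConjugateDominationInfraredMinimumUncertaintyStrength
import Summits.AtomisticToContinuum.BoseEinsteinCondensation.Theorems.InfraredMinimumUncertainty.Negative.MinimalityLoadBearing
import HarnessLib

/-!
# STRATEGY CENSUS sketch — crux `InfraredMinimumUncertainty` (stmt-AtomisticToContinuum-11784)

Typed companions of `STRATEGY-CENSUS.md` (crux-strategist / wall-breaker seat
planner-cstrat-stmt-AtomisticToContinuum-11784-p1-0, 2026-08-17).  Every `def … : Prop` is a
STATEMENT used only to make a census entry precise (a strengthening S⁺, a split piece, the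
negation shape, a transfer image); nothing here is asserted.  The few `theorem`s are pure logic
(window split ⇔ crux; QuarterLaw ⇒ crux; negation shape) or pointers to landed certificates.
No `sorry`.
-/

noncomputable section

open MeasureTheory Filter Set
open scoped ENNReal NNReal Topology

namespace Summit.AtomisticToContinuum.BoseEinsteinCondensation.Cruxes.InfraredMinimumUncertainty.StrategyCensus

open Literature.MathematicalPhysics.QuantumManyBody.BoseGas
open Summit.AtomisticToContinuum.BoseEinsteinCondensation.Theses.BECConjugateDomination
  (InfraredMinimumUncertainty SmoothPeriodicBEC PuffFloor NearMinimiserStability)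
open Summit.AtomisticToContinuum.BoseEinsteinCondensation.Cruxes.InfraredMinimumUncertainty.FisherGaussianDensityMode
  (CruxFrame InSmoothClass IsPositiveMinimiser coherence levyWeight structureFactor waveVec
    InfraredMinimumUncertaintyNamed infraredMinimumUncertainty_iff_named LevyFreeScaleLaw)
open Summit.AtomisticToContinuum.BoseEinsteinCondensation.Theorems.InfraredMinimumUncertainty.Negative
  (InfraredMinimumUncertaintyNearMinimisers not_infraredMinimumUncertaintyNearMinimisers
    InfraredMinimumUncertaintyWithoutMinimality imu_false_without_minimality)

/-! ## §0  Where the crux sits (pointers to LANDED certificates; nothing new) -/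

/-- IMU alone ⇒ the route target (thermodynamic-limit torus BEC, smooth class). [landed, c2] -/
example : InfraredMinimumUncertainty → SmoothPeriodicBEC :=
  Summit.AtomisticToContinuum.BoseEinsteinCondensation.Theorems.BECConjugateDomination.smoothPeriodicBEC_of_infraredMinimumUncertainty

/-- IMU ⇒ the free-scale Lévy law, which is ALL the deciding chain consumes. [landed, c1/c2] -/
example : InfraredMinimumUncertainty → LevyFreeScaleLaw :=
  Summit.AtomisticToContinuum.BoseEinsteinCondensation.Theorems.BECConjugateDomination.levyFreeScaleLaw_of_infraredMinimumUncertainty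

/-- Minimality is load-bearing: the near-minimiser strengthening is FALSE (free density wave). [landed, cdisprove] -/
example : ¬ InfraredMinimumUncertaintyNearMinimisers := not_infraredMinimumUncertaintyNearMinimisers

example : ¬ InfraredMinimumUncertaintyWithoutMinimality := imu_false_without_minimality

/-! ## §S  STRENGTHEN — typed S⁺ candidates -/

/-- **S⁺1 `QuarterLaw`** (the card's sharp form): `Π_m = N ν_m S_m ≤ 1/4` at every mode.  The constant
slot of `CruxFrame` is unused.  Haldane's harmonic fixed point has `Π ≡ 1/4`; Bogoliubov `Π < 1/4`. -/
def QuarterLaw : Prop :=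
  CruxFrame fun _ ρ n Ψ => ∀ m : Fin 3 → ℤ, m ≠ 0 →
    ((n : ℝ) + 1) * levyWeight n (sideLength ρ (n + 1)) Ψ m *
      structureFactor n (sideLength ρ (n + 1)) Ψ m ≤ 1 / 4

/-- `QuarterLaw ⇒ IMU` (trivially, `C = 1/4`): the strengthening adds a constant, no structure. -/
theorem imu_of_quarterLaw : QuarterLaw → InfraredMinimumUncertainty := by
  intro h
  rw [← infraredMinimumUncertainty_iff_named]
  intro v hv₁ hv₂ hv₃ hv₄
  obtain ⟨_, _, ρ₀, hρ₀, hh⟩ := h v hv₁ hv₂ hv₃ hv₄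
  refine ⟨1 / 4, by norm_num, ρ₀, hρ₀, fun ρ hρ hρ' => ?_⟩
  filter_upwards [hh ρ hρ hρ'] with n hn Ψ h1 h2 h3 h4 m hm using hn Ψ h1 h2 h3 h4 m hm

/-- The occupation fraction `n_q / N = Re ĉ_q(g)` of the plane wave `q` (one-body density matrix
of a real non-negative state, translation-averaged: `n_q = N·ĉ_q(g)`). -/
def occupationFrac (n : ℕ) (L : ℝ) (Ψ : PeriodicTrialState (n + 1) L) (q : Fin 3 → ℤ) : ℝ :=
  (cellFourierCoeff L (fun r : Space => ((coherence n L Ψ r : ℝ) : ℂ)) q).re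

/-- The two-branch Bogoliubov envelope `w_Θ(s) = min(√Θ/s, Θ²/s⁴)` (here `Θ` already carries the
factor `ρ`): Bogoliubov `v_k² ≈ √(πρa)/k` for `k² ≪ ρa`, `≈ 16π²ρ²a²/k⁴` for `k² ≫ ρa`. -/
def bogEnvelope (Θ s : ℝ) : ℝ := min (Real.sqrt Θ / s) (Θ ^ 2 / s ^ 4)

/-- **S⁺4 / split child `OccupationDomination`** (torus Gaussian domination for the positive
minimiser, ALL modes, two-branch min form; the minimiser-frame analogue of `PeriodicIRBound`
(stmt-3972, window form, near-minimisers) plus a UV branch): `n_q ≤ C·w_{Cρ}(‖k_q‖)`.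
One constant `C` serves as prefactor and healing scale (both sides are monotone in it).
`v ≡ 0`: `n_q = 0` for `q ≠ 0`, true.  BEC-strength: it closes `SmoothPeriodicBEC` by mode counting
WITHOUT the crux (see `OccupationDominationClosesTarget`). A statement, not a fact. -/
def OccupationDomination : Prop :=
  CruxFrame fun C ρ n Ψ => ∀ q : Fin 3 → ℤ, q ≠ 0 →
    ((n : ℝ) + 1) * occupationFrac n (sideLength ρ (n + 1)) Ψ q ≤
      C * bogEnvelope (C * ρ) ‖waveVec (sideLength ρ (n + 1)) q‖

/-- The crux frame with the potential passed to the body (needed when the healing scale is the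
scattering length of `v`). `CruxFrame P = CruxFrameV (fun _ => P)` by `rfl`. -/
def CruxFrameV
    (P : (ℝ → ℝ≥0∞) → ℝ → ∀ (ρ : ℝ) (n : ℕ), PeriodicTrialState (n + 1) (sideLength ρ (n + 1)) → Prop) :
    Prop :=
  ∀ v : ℝ → ℝ≥0∞, IsRepulsiveFiniteRange v → (∀ r, v r ≠ ⊤) →
    ContDiff ℝ 2 (fun x : Space => (v ‖x‖).toReal) →
    (∃ Cₑ : ℝ, ∀ x : Space,
      ‖iteratedFDeriv ℝ 2 (fun x : Space => (v ‖x‖).toReal) x‖ ≤ Cₑ * Real.sqrt ((v ‖x‖).toReal)) →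
    ∃ C : ℝ, 0 ≤ C ∧ ∃ ρ₀ : ℝ, 0 < ρ₀ ∧ ∀ ρ : ℝ, 0 < ρ → ρ < ρ₀ → ∀ᶠ n : ℕ in atTop,
      ∀ Ψ : PeriodicTrialState (n + 1) (sideLength ρ (n + 1)),
        periodicEnergy v Ψ = periodicGroundStateEnergy v (n + 1) (sideLength ρ (n + 1)) →
        periodicEnergy v Ψ ≠ ⊤ → (∀ X, Ψ.ψ X = (‖Ψ.ψ X‖ : ℂ)) → (∀ X, Ψ.ψ X ≠ 0) → P v C ρ n Ψ

theorem cruxFrameV_const (P : ℝ → ∀ (ρ : ℝ) (n : ℕ), PeriodicTrialState (n + 1) (sideLength ρ (n + 1)) → Prop) :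
    CruxFrameV (fun _ => P) ↔ CruxFrame P := Iff.rfl

/-- **S⁺5 / split child `HealedStructureFactorCeiling`** (Feynman–Landau ceiling healed by the
scattering length, all modes): `S_m ≤ C‖k‖/√(‖k‖² + ρ·a(v))`.  At `v ≡ 0` (`a = 0`) it reads `S ≤ C`,
true — this repairs the refuted bare-`ρ` form `StructureFactorCeiling`
(`Negative/StructureFactorCeilingFalse.lean`).  Implied by `StaticResponseBound` (stmt-12057) via
`m₀² ≤ m₁ m₋₁`; Landau-floor strength in the infrared. A statement, not a fact. -/
def HealedStructureFactorCeiling : Prop :=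
  CruxFrameV fun v C ρ n Ψ => ∀ m : Fin 3 → ℤ, m ≠ 0 →
    structureFactor n (sideLength ρ (n + 1)) Ψ m ≤
      C * ‖waveVec (sideLength ρ (n + 1)) m‖ /
        Real.sqrt (‖waveVec (sideLength ρ (n + 1)) m‖ ^ 2 + ρ * (scatteringLength v).toReal)

/-! ## §D  DECOMPOSITION — typed splits -/

/-- Split D1, infrared piece: the crux restricted to the phonon window `‖k‖ ≤ K√ρ`. -/
def IMUInfraredWindow (K : ℝ) : Prop :=
  CruxFrame fun C ρ n Ψ => ∀ m : Fin 3 → ℤ, m ≠ 0 →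
    ‖waveVec (sideLength ρ (n + 1)) m‖ ≤ K * Real.sqrt ρ →
    ((n : ℝ) + 1) * levyWeight n (sideLength ρ (n + 1)) Ψ m *
      structureFactor n (sideLength ρ (n + 1)) Ψ m ≤ C

/-- Split D1, ultraviolet piece: the crux beyond the phonon window. -/
def IMUUltravioletTail (K : ℝ) : Prop :=
  CruxFrame fun C ρ n Ψ => ∀ m : Fin 3 → ℤ, m ≠ 0 →
    K * Real.sqrt ρ < ‖waveVec (sideLength ρ (n + 1)) m‖ →
    ((n : ℝ) + 1) * levyWeight n (sideLength ρ (n + 1)) Ψ m *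
      structureFactor n (sideLength ρ (n + 1)) Ψ m ≤ C

/-- **Glue of split D1** (kernel-checked): window ∧ tail ⇒ crux (`C = max`, `ρ₀ = min`, case on `‖k‖`). -/
theorem imu_of_windows (K : ℝ) :
    IMUInfraredWindow K → IMUUltravioletTail K → InfraredMinimumUncertainty := by
  intro hIR hUV
  rw [← infraredMinimumUncertainty_iff_named]
  intro v hv₁ hv₂ hv₃ hv₄
  obtain ⟨C₁, hC₁, ρ₁, hρ₁, h₁⟩ := hIR v hv₁ hv₂ hv₃ hv₄
  obtain ⟨C₂, _, ρ₂, hρ₂, h₂⟩ := hUV v hv₁ hv₂ hv₃ hv₄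
  refine ⟨max C₁ C₂, le_max_of_le_left hC₁, min ρ₁ ρ₂, lt_min hρ₁ hρ₂, fun ρ hρ hρ₀ => ?_⟩
  filter_upwards [h₁ ρ hρ (lt_of_lt_of_le hρ₀ (min_le_left _ _)),
    h₂ ρ hρ (lt_of_lt_of_le hρ₀ (min_le_right _ _))] with n hn₁ hn₂
  intro Ψ hE hfin hreal hpos m hm
  rcases le_or_gt ‖waveVec (sideLength ρ (n + 1)) m‖ (K * Real.sqrt ρ) with hk | hk
  · exact (hn₁ Ψ hE hfin hreal hpos m hm hk).trans (le_max_left _ _)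
  · exact (hn₂ Ψ hE hfin hreal hpos m hm hk).trans (le_max_right _ _)

/-- Converse (the split is exact): crux ⇒ window ∧ tail. -/
theorem windows_of_imu (K : ℝ) :
    InfraredMinimumUncertainty → IMUInfraredWindow K ∧ IMUUltravioletTail K := by
  intro h
  rw [← infraredMinimumUncertainty_iff_named] at h
  constructor
  · intro v hv₁ hv₂ hv₃ hv₄
    obtain ⟨C, hC, ρ₀, hρ₀, hh⟩ := h v hv₁ hv₂ hv₃ hv₄
    refine ⟨C, hC, ρ₀, hρ₀, fun ρ hρ hρ' => ?_⟩
    filter_upwards [hh ρ hρ hρ'] with n hn Ψ h1 h2 h3 h4 m hm _ using hn Ψ h1 h2 h3 h4 m hm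
  · intro v hv₁ hv₂ hv₃ hv₄
    obtain ⟨C, hC, ρ₀, hρ₀, hh⟩ := h v hv₁ hv₂ hv₃ hv₄
    refine ⟨C, hC, ρ₀, hρ₀, fun ρ hρ hρ' => ?_⟩
    filter_upwards [hh ρ hρ hρ'] with n hn Ψ h1 h2 h3 h4 m hm _ using hn Ψ h1 h2 h3 h4 m hm

/-- **Split D2, the provable child `LevySandwich`** (pure harmonic analysis on the 3-torus; M/L):
for a continuous, even, `L`-periodic, pointwise-positive `g` with non-negative summable Fourier
coefficients, `g(0) = 1` and mean `ĉ₀(g) ≥ 3/4`, every quasi-monotone envelope `w` of the non-zero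
coefficients (`w(q') ≤ A j⁴ w(q)` whenever `‖k_q‖ ≤ j‖k_{q'}‖`) dominates the Lévy weights:
`Re ĉ_m(log g) ≤ K·A·w(m)` with ONE absolute `K`.  Proof sketch (c2, dead-line record item 4):
`g = a(1+u)`, `a = ĉ₀(g) ≥ 3/4`, `θ = ∑_{q≠0} û_q = (1−a)/a ≤ 1/3`, `log g = log a + ∑ (−1)^{j+1}u^j/j`,
`ĉ_m(u^j) = û^{*j}_m ≥ 0` so `ĉ_m(log g) ≤ ∑_{j odd} ĉ_m(u^j)/j ≤ ∑_{j odd} max_{‖k_q‖ ≥ ‖k_m‖/j} û_q · θ^{j−1}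
≤ (A/a) w(m) ∑_j j⁴ 3^{1−j}`.  A statement (provable), not a fact. -/
def LevySandwich : Prop :=
  ∃ K : ℝ, 0 ≤ K ∧ ∀ L : ℝ, 0 < L → ∀ g : Space → ℝ, Continuous g →
    (∀ r : Space, 0 < g r) → (∀ (r : Space) (j : Fin 3), g (r + EuclideanSpace.single j L) = g r) →
    (∀ r, g (-r) = g r) → g 0 = 1 →
    (∀ q : Fin 3 → ℤ, 0 ≤ (cellFourierCoeff L (fun r => ((g r : ℝ) : ℂ)) q).re) →
    Summable (fun q : Fin 3 → ℤ => (cellFourierCoeff L (fun r => ((g r : ℝ) : ℂ)) q).re) →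
    3 / 4 ≤ (cellFourierCoeff L (fun r => ((g r : ℝ) : ℂ)) 0).re →
    ∀ (A : ℝ) (w : (Fin 3 → ℤ) → ℝ), 0 ≤ A → (∀ q, 0 ≤ w q) →
      (∀ (j : ℕ) (q q' : Fin 3 → ℤ), 1 ≤ j → q ≠ 0 → q' ≠ 0 →
        ‖waveVec L q‖ ≤ j * ‖waveVec L q'‖ → w q' ≤ A * (j : ℝ) ^ 4 * w q) →
      (∀ q : Fin 3 → ℤ, q ≠ 0 → (cellFourierCoeff L (fun r => ((g r : ℝ) : ℂ)) q).re ≤ w q) →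
      ∀ m : Fin 3 → ℤ, m ≠ 0 →
        (cellFourierCoeff L (fun r => ((Real.log (g r) : ℝ) : ℂ)) m).re ≤ K * A * w m

/-- **Glue of split D2** (the c2 "standard-pair sandwich", as a statement; NOT proved here — it needs,
besides the three children, landed facts: regularity/positivity/evenness of `g` (`stub_coherenceRegular`),
positive-definiteness `ĉ_q(g) = n_q/N ≥ 0`, the `d = 3` lattice sum giving `ĉ₀(g) ≥ 3/4` at small `ρ`
(`IMUChainGlueLattice`), the envelope algebra `w_{Cρ}·S ≤ C'` in both windows, and the `v ≡ 0` case
`body_zero`).  Its hardest child `OccupationDomination` closes the route target WITHOUT the crux, so the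
split is DOMINATED (see the census, § Decomposition). -/
def StandardPairGlue : Prop :=
  OccupationDomination → HealedStructureFactorCeiling → LevySandwich → InfraredMinimumUncertainty

/-- **Dominance** (statement; the minimiser-frame twin of the LANDED `IRModeCounting_proof`, stmt-4246,
plus `nearMinimiserStability_proof`, stmt-11788): the occupation child alone closes the target. -/
def OccupationDominationClosesTarget : Prop :=
  OccupationDomination → SmoothPeriodicBEC

/-! ## §N  NEGATION — the shape of a counterexample -/

/-- What `¬ IMU` requires: ONE smooth-class `v` such that for every `C` and every density ceiling there is a
smaller density at which, for infinitely many `N`, some positive minimiser has a mode with `Π_m > C`. -/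
def IMUCounterexampleShape : Prop :=
  ∃ v : ℝ → ℝ≥0∞, InSmoothClass v ∧ ∀ C : ℝ, 0 ≤ C → ∀ ρ₀ : ℝ, 0 < ρ₀ → ∃ ρ : ℝ, 0 < ρ ∧ ρ < ρ₀ ∧
    ∃ᶠ n : ℕ in atTop, ∃ Ψ : PeriodicTrialState (n + 1) (sideLength ρ (n + 1)),
      IsPositiveMinimiser v Ψ ∧ ∃ m : Fin 3 → ℤ, m ≠ 0 ∧
        C < ((n : ℝ) + 1) * levyWeight n (sideLength ρ (n + 1)) Ψ m *
          structureFactor n (sideLength ρ (n + 1)) Ψ m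

/-- A counterexample of that shape refutes the crux (the easy direction, kernel-checked). -/
theorem not_imu_of_counterexample : IMUCounterexampleShape → ¬ InfraredMinimumUncertainty := by
  rintro ⟨v, ⟨hv₁, hv₂, hv₃, hv₄⟩, h⟩ hI
  rw [← infraredMinimumUncertainty_iff_named] at hI
  obtain ⟨C, hC, ρ₀, hρ₀, hh⟩ := hI v hv₁ hv₂ hv₃ hv₄
  obtain ⟨ρ, hρ, hρ', hfreq⟩ := h C hC ρ₀ hρ₀
  apply hfreq
  filter_upwards [hh ρ hρ hρ'] with n hn
  rintro ⟨Ψ, ⟨h1, h2, h3, h4⟩, m, hm, hlt⟩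
  exact absurd (hn Ψ h1 h2 h3 h4 m hm) (not_le.mpr hlt)

/-- And conversely: the negation of the crux HAS that shape (so a refuter must produce a `v`). -/
theorem counterexample_of_not_imu : ¬ InfraredMinimumUncertainty → IMUCounterexampleShape := by
  intro h
  rw [← infraredMinimumUncertainty_iff_named] at h
  unfold InfraredMinimumUncertaintyNamed CruxFrame at h
  push Not at h
  obtain ⟨v, hv₁, hv₂, hv₃, hv₄, h⟩ := h
  refine ⟨v, ⟨hv₁, hv₂, hv₃, hv₄⟩, fun C hC ρ₀ hρ₀ => ?_⟩
  obtain ⟨ρ, hρ, hρ', hh⟩ := h C hC ρ₀ hρ₀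
  refine ⟨ρ, hρ, hρ', ?_⟩
  refine hh.mono ?_
  rintro n ⟨Ψ, h1, h2, h3, h4, m, hm, hlt⟩
  exact ⟨Ψ, ⟨h1, h2, h3, h4⟩, m, hm, hlt⟩

/-! ## §T  TRANSFER — the solved sibling's version of exactly this step -/

/-- Gross–Pitaevskii scaling of a potential on the unit torus: `v_N(r) = N² v(N r)` (scattering length `a/N`). -/
def scaledPotential (v : ℝ → ℝ≥0∞) (N : ℕ) : ℝ → ℝ≥0∞ := fun r => (N : ℝ≥0∞) ^ 2 * v (N * r)

/-- **T1 `IMUGrossPitaevskiiRegime`**: the crux's body for the positive minimiser of `N` bosons on the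
UNIT torus with the GP-scaled potential (box = healing length; finitely many relevant modes, each at
Bogoliubov parameter `x_m = ‖2πm‖²ξ² ≳ 1`).  Expected to follow from the norm approximation of the GP-regime
ground state by the Bogoliubov vacuum [LiebSeiringer2002, BoccatoEtAl2019Acta, BrenneckeSchleinSchraven2022];
it is NOT the crux (there `ρ` is fixed and `L = (N/ρ)^{1/3} → ∞`). A statement, not a fact. -/
def IMUGrossPitaevskiiRegime : Prop :=
  ∀ v : ℝ → ℝ≥0∞, InSmoothClass v → ∃ C : ℝ, 0 ≤ C ∧ ∀ᶠ n : ℕ in atTop,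
    ∀ Ψ : PeriodicTrialState (n + 1) 1, IsPositiveMinimiser (scaledPotential v (n + 1)) Ψ →
      ∀ m : Fin 3 → ℤ, m ≠ 0 →
        ((n : ℝ) + 1) * levyWeight n 1 Ψ m * structureFactor n 1 Ψ m ≤ C

end Summit.AtomisticToContinuum.BoseEinsteinCondensation.Cruxes.InfraredMinimumUncertainty.StrategyCensus

end
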